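import Literature.Topology.FourManifolds.CircleProdSumUniqueness
import Literature.Topology.FourManifolds.OrientedConnectedSumAssoc
import Literature.Topology.FourManifolds.OrientedConnectedSumExistence
import Literature.Topology.FourManifolds.RechartOrientation
import Literature.Topology.FourManifolds.ComplexProjectiveSpaceOrientationProofs
import Literature.Topology.FourManifolds.ConnectedSumProofs
import Literature.Topology.FourManifolds.ChartTransport
import HarnessLib

/-!
# `#ᵐ(S¹ × S³) # #ⁿ(S¹ × S³) = #ᵐ⁺ⁿ(S¹ × S³)`: additivity of the normal form `IsCircleProdSum`

Topic `Literature/Topology/FourManifolds`, proofs companion of `LargeKTrisectionClassification.lean`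
(the Meier–Schirmer–Zupan classification fact `msz_trisection_classification_gk`) and sequel of
`CircleProdSumUniqueness.lean`.  In the printed proof of MSZ Thm. 1.2 (Proc. AMS 144 (2016),
§5) the conclusion is assembled along a connected sum of trisections: "By the inductive
hypothesis, both `𝒯′` and `𝒯″` satisfy the conclusions of the theorem", whence `X = X′ # X″`
does — i.e. `#ᵃ(S¹ × S³) # #ᵇ(S¹ × S³) ≅ #ᵃ⁺ᵇ(S¹ × S³)` and
`#ᵃ(S¹ × S³) # (#ᵇ(S¹ × S³) # ℂP²) ≅ #ᵃ⁺ᵇ(S¹ × S³) # ℂP²`, the connected-sum arithmetic of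
Kervaire–Milnor ("The connected sum operation is well defined, associative, and commutative up to
orientation preserving diffeomorphism", Lemma 2.1).  In the tree's relational language
(`IsConnectedSum`, along arbitrary discs, NO orientation data) this re-bracketing is not formal:
the tree proves associativity for ORIENTED connected sums (`isOrientedConnectedSum_assoc_holds`).
This file supplies the missing bridge and the arithmetic, everything PROVED (no definition, no
named fact):

* `Literature.Topology.FourManifolds.IsConnectedSum.exists_isOrientedConnectedSum` — **an
  unoriented connected sum of oriented manifolds is an oriented connected sum for suitable
  orientations**: if `P` is a connected sum `M # N` of smooth `n`-manifolds on `ℝⁿ` (`n ≠ 0`) and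
  `oM`, `oN` are orientations, then for `oN′ ∈ {oN, −oN}` and some orientation `oP` of `P`,
  `(P, oP) = (M, oM) # (N, oN′)` (`IsOrientedConnectedSum`).  Proof: invert the discs to charts
  (`exists_chart_of_isSmoothEmbedding`), so that Kosinski's glued model `T` of these very
  connected-sum data (`ConnectedSumData.Glued`, `OrientedConnectedSumExistence.lean`) is an open
  gluing of the SAME punctured pieces along the SAME relation as `P`; choose the constant
  orientation `o₀` of `ℝⁿ` making `i₁` orientation preserving and flip `oN` if necessary to make
  `i₂` reversing (`isOrientationPreserving_or_isOrientationReversing_disc`), orient `T`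
  (`ConnectedSumData.orientation`), compare `T ≅ P` by the uniqueness of open gluings
  (`IsOpenGluing.exists_diffeomorph_comp_eq` — no disc theorem is needed) and push the orientation
  forward (`Diffeomorph.exists_isOrientationPreserving`).  Corollary
  `IsConnectedSum.isOrientable_of_isOrientable`: a connected sum of orientable manifolds is
  orientable (Kosinski VI (1.1): "oriented if both `M₁`, `M₂` are oriented").
* `Literature.Topology.FourManifolds.exists_circleProdSphereThree_euclidean` — a closed connected
  ORIENTABLE copy of `S¹ × S³` charted on `ℝ⁴`, in any universe (recharting Mathlib's
  `Circle × 𝕊³`, `IsOrientable.rechart`, `isOrientable_circle`, `isOrientable_sphere_holds`,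
  `ManifoldShrink`).
* `Literature.Topology.FourManifolds.IsCircleProdSum.isOrientable` — `#ᵏ(S¹ × S³)` is orientable.
* `Literature.Topology.FourManifolds.IsConnectedSum.exists_rebracket` — **re-bracketing
  `P # (M # R) ⇝ (P # M) # R` for unoriented sums of closed connected orientable manifolds**
  (`n ≥ 2`): given `Q = M # R` and `X = P # Q` there is a closed connected `Y = P # M` with
  `X = Y # R` — orient everything by the first item, form oriented `Y = P # M`, `Z = Y # R`
  (`exists_isOrientedConnectedSum_holds`), identify `Z ≅ X` by
  `isOrientedConnectedSum_assoc_holds` and transport (`IsConnectedSum.of_diffeomorph`).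
* `Literature.Topology.FourManifolds.IsCircleProdSum.add` — **additivity**:
  `IsCircleProdSum m P → IsCircleProdSum n Q → IsConnectedSum P Q X → IsCircleProdSum (m + n) X`
  for closed connected smooth `P`, `Q` and closed smooth `X` (induction on `n`, re-bracketing one
  `S¹ × S³` summand at a time, recharted on `ℝ⁴` and back by
  `IsConnectedSum.of_diffeomorph_right_of_boundaryless`); `.add_left` the commuted form.
* `Literature.Topology.FourManifolds.IsCircleProdSum.add_isConnectedSum_complexProjectivePlane`,
  `.isConnectedSum_complexProjectivePlane_add` — the `ℂP²` summand moves to the outside: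
  `#ᵐ # (#ⁿ # ℂP²)` and `(#ᵐ # ℂP²) # #ⁿ` are `#ᵐ⁺ⁿ # ℂP²` in the relational sense (orientability
  of `ℂP²`: `isOrientable_complexProjectivePlane_holds`), the second alternative of
  `msz_trisection_classification_gk`.

## References

* J. Meier, T. Schirmer, A. Zupan, *Classification of trisections and the Generalized Property R
  Conjecture*, Proc. AMS 144 (2016) 4983–4997 (arXiv:1507.06561), proof of Thm. 1.2, §5.
  [MeierSchirmerZupan2016]
* M. Kervaire, J. Milnor, *Groups of homotopy spheres I*, Ann. of Math. 77 (1963), §2,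
  Lemma 2.1 (p. 505). [KervaireMilnorAnnals1963]
* A. Kosinski, *Differential Manifolds* (1993), Ch. VI §1, Thm. (1.1). [Kosinski1993]
* M. W. Hirsch, *Differential Topology*, GTM 33 (1976), §4.4 (orientations under
  diffeomorphisms). [HirschDT1976]
-/

noncomputable section

open scoped Manifold ContDiff Topology
open Set Module Function Filter
open Literature.Geometry.Manifold (Rechart)

namespace Literature.Topology.FourManifolds

universe u v w

/-! ### Unoriented connected sums of oriented manifolds are oriented connected sums -/

section Upgrade

variable {n : ℕ} {M : Type u} {N : Type v} {P : Type w}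
  [TopologicalSpace M] [T2Space M] [ChartedSpace (EuclideanSpace ℝ (Fin n)) M]
  [IsManifold (𝓡 n) ∞ M]
  [TopologicalSpace N] [T2Space N] [ChartedSpace (EuclideanSpace ℝ (Fin n)) N]
  [IsManifold (𝓡 n) ∞ N]
  [TopologicalSpace P] [ChartedSpace (EuclideanSpace ℝ (Fin n)) P] [IsManifold (𝓡 n) ∞ P]

/-- **An unoriented connected sum of oriented manifolds is an oriented connected sum, for
suitable orientations.**  Let `P` be a connected sum `M # N` (the tree's `IsConnectedSum`: `P`
is an open gluing of `M ∖ {i₁ 0}` and `N ∖ {i₂ 0}` along Kervaire–Milnor's relation for some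
discs `i₁`, `i₂`) of smooth `n`-manifolds on `ℝⁿ`, `n ≠ 0`, and let `oM`, `oN` be orientations
of `M`, `N`.  Then for `oN′ = oN` or `oN′ = −oN` there is an orientation `oP` of `P` with
`IsOrientedConnectedSum oM oN′ oP` (`i₁` orientation preserving and `i₂` orientation reversing
for one constant orientation of `ℝⁿ`, the gluing embeddings orientation preserving).  Proof:
invert the discs to smooth charts `Φ₁`, `Φ₂` onto `ℝⁿ` (`exists_chart_of_isSmoothEmbedding`) and
let `D = (Φ₁, Φ₂)` be the resulting connected-sum data, so `D.i₁ = i₁`, `D.i₂ = i₂`; choose `o₀`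
with `i₁` preserving `(o₀, oM)` (`exists_isOrientationPreserving_disc`) and `oN′ = ±oN` with
`i₂` reversing `(o₀, oN′)` (`isOrientationPreserving_or_isOrientationReversing_disc`).
Kosinski's glued model `T = D.Glued` carries the glued orientation `oT`
(`ConnectedSumData.orientation`, its two open pieces orientation preserving) and is an open
gluing of the same pieces along the same relation as `P`, hence `Ψ : T ≅ P` with
`Ψ ∘ inl = jA`, `Ψ ∘ inr = jB` (`IsOpenGluing.exists_diffeomorph_comp_eq`); `oP = Ψ(oT)`
(`Diffeomorph.exists_isOrientationPreserving`) makes `jA`, `jB` orientation preserving (chain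
rule, `IsOrientationPreserving.comp_holds`).  (Kervaire–Milnor 1963, §2; Kosinski 1993,
VI (1.1): "`M₁ # M₂` is … oriented if both `M₁`, `M₂` are oriented"; Hirsch §4.4.)
[cite: Kosinski1993, Ch. VI §1, Thm (1.1)] [cite: KervaireMilnorAnnals1963, §2, Lemma 2.1 (p. 505)] -/
theorem IsConnectedSum.exists_isOrientedConnectedSum (hn : n ≠ 0)
    (h : IsConnectedSum (𝓡 n) (𝓡 n) (𝓡 n) M N P) (oM : SmoothOrientation (𝓡 n) M)
    (oN : SmoothOrientation (𝓡 n) N) :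
    ∃ (oN' : SmoothOrientation (𝓡 n) N) (oP : SmoothOrientation (𝓡 n) P),
      (oN' = oN ∨ oN' = -oN) ∧ IsOrientedConnectedSum oM oN' oP := by
  obtain ⟨i₁, i₂, hi₁, hi₂, jA, jB, hA, hAo, hB, hBo, hU, hR⟩ := h
  have hinf : (∞ : ℕ∞ω) ≠ 0 := by simp
  -- charts inverting the discs
  obtain ⟨Φ₁, hΦ₁t, hΦ₁e, -, hΦ₁c⟩ := exists_chart_of_isSmoothEmbedding hi₁
  obtain ⟨Φ₂, hΦ₂t, hΦ₂e, -, hΦ₂c⟩ := exists_chart_of_isSmoothEmbedding hi₂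
  subst hΦ₁e hΦ₂e
  have hΦ₁m : Φ₁ ∈ IsManifold.maximalAtlas (𝓡 n) ∞ M :=
    Φ₁.mem_maximalAtlas_of_contMDiffOn hΦ₁c (by
      rw [hΦ₁t]; exact hi₁.contMDiff.contMDiffOn)
  have hΦ₂m : Φ₂ ∈ IsManifold.maximalAtlas (𝓡 n) ∞ N :=
    Φ₂.mem_maximalAtlas_of_contMDiffOn hΦ₂c (by
      rw [hΦ₂t]; exact hi₂.contMDiff.contMDiffOn)
  -- connected sum data on these very discs: `D.i₁ = Φ₁.symm = i₁`, `D.i₂ = Φ₂.symm = i₂`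
  obtain ⟨D, hD₁, hD₂⟩ : ∃ D : ConnectedSumData n M N, D.e₁ = Φ₁ ∧ D.e₂ = Φ₂ :=
    ⟨⟨Φ₁, Φ₂, hΦ₁m, hΦ₂m, hΦ₁t, hΦ₂t⟩, rfl, rfl⟩
  subst hD₁ hD₂
  -- the constant orientation making `i₁` preserving, and `oN' = ±oN` making `i₂` reversing
  obtain ⟨o₀, h₁⟩ :=
    exists_isOrientationPreserving_disc D.isSmoothEmbedding_i₁ D.isOpen_range_i₁ oM
  obtain ⟨oN', hoN', h₂⟩ : ∃ oN' : SmoothOrientation (𝓡 n) N, (oN' = oN ∨ oN' = -oN) ∧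
      IsOrientationReversing (SmoothOrientation.modelSpace o₀) oN' D.i₂ := by
    rcases isOrientationPreserving_or_isOrientationReversing_disc D.isSmoothEmbedding_i₂
      D.isOpen_range_i₂ o₀ oN with h₂ | h₂
    · refine ⟨-oN, Or.inr rfl, ?_⟩
      rw [isOrientationReversing_iff, neg_neg]
      exact h₂
    · exact ⟨oN, Or.inl rfl, h₂⟩
  -- Kosinski's glued model on these data, an open gluing of the same pieces, same relation
  obtain ⟨Ψ, hΨA, hΨB⟩ := IsOpenGluing.exists_diffeomorph_comp_eq
    (D.glueData hn).isSmoothEmbedding_inl (D.glueData hn).isOpen_range_inl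
    (D.glueData hn).isSmoothEmbedding_inr (D.glueData hn).isOpen_range_inr
    (D.glueData hn).range_inl_union_range_inr
    (fun a b => (D.glueData hn).inl_eq_inr_iff.trans (D.connectedSumRel_iff_φ hn a b).symm)
    hA hAo hB hBo hU hR
  -- push the glued orientation forward along `Ψ : T ≅ P`
  obtain ⟨oP, hΨo⟩ := Ψ.exists_isOrientationPreserving hinf (D.orientation hn oM oN' o₀ h₁ h₂)
  have hΨd : MDifferentiable (𝓡 n) (𝓡 n) Ψ := Ψ.mdifferentiable hinf
  have hΨdet := Ψ.det_mfderiv_ne_zero hinf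
  have hjA : IsOrientationPreserving (oM.restrict (puncture D.i₁)) oP jA := by
    have hc := IsOrientationPreserving.comp_holds hΨo
      (D.isOrientationPreserving_inl hn oM oN' o₀ h₁ h₂) hΨd
      ((D.glueData hn).isSmoothEmbedding_inl.contMDiff.mdifferentiable hinf) hΨdet
      (det_mfderiv_ne_zero_of_isSmoothEmbedding (D.glueData hn).isSmoothEmbedding_inl
        (D.glueData hn).isOpen_range_inl)
    have hfun : (Ψ : _ → P) ∘ (D.glueData hn).inl = jA := funext hΨA
    rwa [hfun] at hc
  have hjB : IsOrientationPreserving (oN'.restrict (puncture D.i₂)) oP jB := by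
    have hc := IsOrientationPreserving.comp_holds hΨo
      (D.isOrientationPreserving_inr hn oM oN' o₀ h₁ h₂) hΨd
      ((D.glueData hn).isSmoothEmbedding_inr.contMDiff.mdifferentiable hinf) hΨdet
      (det_mfderiv_ne_zero_of_isSmoothEmbedding (D.glueData hn).isSmoothEmbedding_inr
        (D.glueData hn).isOpen_range_inr)
    have hfun : (Ψ : _ → P) ∘ (D.glueData hn).inr = jB := funext hΨB
    rwa [hfun] at hc
  exact ⟨oN', oP, hoN', D.i₁, D.i₂, o₀, jA, jB, D.isSmoothEmbedding_i₁, D.isSmoothEmbedding_i₂,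
    h₁, h₂, ⟨hA, hAo, hB, hBo, hU, hR⟩, hjA, hjB⟩

/-- **A connected sum of orientable manifolds is orientable** (relational, unoriented
`IsConnectedSum` on `ℝⁿ`, `n ≠ 0`): immediate from
`IsConnectedSum.exists_isOrientedConnectedSum` (Kosinski 1993, VI (1.1): "`M₁ # M₂` is …
oriented if both `M₁`, `M₂` are oriented"). [cite: Kosinski1993, Ch. VI §1, Thm (1.1)] -/
theorem IsConnectedSum.isOrientable_of_isOrientable (hn : n ≠ 0)
    (h : IsConnectedSum (𝓡 n) (𝓡 n) (𝓡 n) M N P) (hM : IsOrientable (𝓡 n) M)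
    (hN : IsOrientable (𝓡 n) N) : IsOrientable (𝓡 n) P := by
  obtain ⟨oM⟩ := hM
  obtain ⟨oN⟩ := hN
  obtain ⟨-, oP, -, -⟩ := h.exists_isOrientedConnectedSum hn oM oN
  exact ⟨oP⟩

end Upgrade

/-! ### An orientable copy of `S¹ × S³` on `ℝ⁴`, in any universe -/

/-- **A closed connected orientable copy of `S¹ × S³` charted on `ℝ⁴`** (any universe): a
compact connected Hausdorff second-countable `C^∞` manifold `R : Type u` on `ℝ⁴`, orientable,
with a diffeomorphism onto Mathlib's `Circle × 𝕊³` (product model).  Construction: the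
recharting `Rechart f (Circle × 𝕊³)` along `ℝ¹ × ℝ³ ≃L ℝ⁴` (Lee 2013, Prop. 1.17; the tree's
`exists_rechart_circle_prod_sphereThree`) is orientable by `IsOrientable.rechart` from the product
orientation (`isOrientable_circle`, `isOrientable_sphere_holds`, `IsOrientable.prod`; Hirsch
Ch. 5 §1), and is moved to universe `u` by `Shrink` (`ManifoldShrink.diffeomorph`,
`ManifoldShrink.isOrientable`). [cite: HirschDT1976, Ch. 5 §1] -/
theorem exists_circleProdSphereThree_euclidean :
    ∃ (R : Type u) (_ : TopologicalSpace R) (_ : T2Space R) (_ : SecondCountableTopology R)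
      (_ : ChartedSpace (EuclideanSpace ℝ (Fin 4)) R) (_ : IsManifold (𝓡 4) ∞ R)
      (_ : CompactSpace R) (_ : ConnectedSpace R),
      IsOrientable (𝓡 4) R ∧
        Nonempty (R ≃ₘ⟮𝓡 4, (𝓡 1).prod (𝓡 3)⟯
          (Circle × (Metric.sphere (0 : EuclideanSpace ℝ (Fin 4)) 1))) := by
  haveI := Fact.mk (@finrank_euclideanSpace_fin ℝ _ 4)
  let L : (EuclideanSpace ℝ (Fin 1) × EuclideanSpace ℝ (Fin 3)) ≃L[ℝ]
      EuclideanSpace ℝ (Fin 4) := ContinuousLinearEquiv.ofFinrankEq (by simp)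
  let f : ModelProd (EuclideanSpace ℝ (Fin 1)) (EuclideanSpace ℝ (Fin 3)) ≃ₜ
      EuclideanSpace ℝ (Fin 4) := L.toHomeomorph
  have hIf : ∀ x, f x = L (((𝓡 1).prod (𝓡 3)) x) := fun x => rfl
  have hf :=
    Rechart.contMDiff_of_apply_eq_linear (I := (𝓡 1).prod (𝓡 3)) (n := ∞) f L hIf
  have hf' :=
    Rechart.contMDiff_symm_of_apply_eq_linear (I := (𝓡 1).prod (𝓡 3)) (n := ∞) f L hIf
  let R₀ : Type := Rechart f (Circle × (Metric.sphere (0 : EuclideanSpace ℝ (Fin 4)) 1))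
  haveI hR₀ : IsManifold (𝓡 4) ∞ R₀ := Rechart.isManifold f _ hf hf'
  let Φ₀ : R₀ ≃ₘ⟮𝓡 4, (𝓡 1).prod (𝓡 3)⟯ (Circle × (Metric.sphere (0 : EuclideanSpace ℝ (Fin 4)) 1)) :=
    { toFun := Rechart.out f _
      invFun := Rechart.into f _
      left_inv := fun x => Rechart.into_out f _ x
      right_inv := fun x => Rechart.out_into f _ x
      contMDiff_toFun := Rechart.contMDiff_out f _ hf hf'
      contMDiff_invFun := Rechart.contMDiff_into f _ hf hf' }
  -- connectedness, second countability, orientability of the model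
  haveI : ConnectedSpace (Metric.sphere (0 : EuclideanSpace ℝ (Fin 4)) 1) := by
    refine isConnected_iff_connectedSpace.mp (isConnected_sphere ?_ 0 zero_le_one)
    rw [← Module.finrank_eq_rank, finrank_euclideanSpace_fin]
    norm_num
  haveI : ConnectedSpace R₀ := Φ₀.symm.surjective.connectedSpace Φ₀.symm.continuous
  haveI : SecondCountableTopology R₀ := Φ₀.toHomeomorph.secondCountableTopology
  have hC : IsOrientable ((𝓡 1).prod (𝓡 3))
      (Circle × (Metric.sphere (0 : EuclideanSpace ℝ (Fin 4)) 1)) :=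
    isOrientable_circle.prod (isOrientable_sphere_holds 3)
  have hR₀o : IsOrientable (𝓡 4) R₀ := IsOrientable.rechart f L _ hIf hC
  -- move to universe `u`
  haveI : Small.{u} R₀ := small_max.{u} R₀
  let φ : Shrink.{u} R₀ ≃ₘ⟮𝓡 4, 𝓡 4⟯ R₀ := ManifoldShrink.diffeomorph.{u} (𝓡 4) R₀ ∞
  exact ⟨Shrink.{u} R₀, inferInstance, inferInstance, inferInstance, inferInstance, inferInstance,
    inferInstance, inferInstance, ManifoldShrink.isOrientable hR₀o, ⟨φ.trans Φ₀⟩⟩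

/-! ### `#ᵏ(S¹ × S³)` is orientable -/

/-- **A connected sum of copies of `S¹ × S³` is orientable**: by induction along the inductive
family, `S⁴` is orientable (`isOrientable_sphere_holds`, transported by
`IsOrientable.of_diffeomorph`), and a connected sum `M # (S¹ × S³)` of orientable summands is
orientable (`IsConnectedSum.isOrientable_of_isOrientable`, after recharting the summand
`Circle × 𝕊³` on `ℝ⁴`, `exists_circleProdSphereThree_euclidean`,
`IsConnectedSum.of_diffeomorph_right_of_boundaryless`).  (Kosinski 1993, VI (1.1).)
[cite: Kosinski1993, Ch. VI §1, Thm (1.1)] -/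
theorem IsCircleProdSum.isOrientable {k : ℕ} {P : Type u} [TopologicalSpace P]
    [ChartedSpace (EuclideanSpace ℝ (Fin 4)) P] (h : IsCircleProdSum k P) :
    ∀ [IsManifold (𝓡 4) ∞ P], IsOrientable (𝓡 4) P := by
  induction h with
  | sphere e =>
    intro _
    exact (isOrientable_sphere_holds 4).of_diffeomorph e.symm (by simp)
  | @succ n M P _ _ _ _ _ _ _ _ _ hM hsum ih =>
    intro _
    haveI := Fact.mk (@finrank_euclideanSpace_fin ℝ _ 4)
    obtain ⟨R, _, _, _, _, _, _, _, hRo, ⟨Φ⟩⟩ := exists_circleProdSphereThree_euclidean.{0}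
    have hsum' : IsConnectedSum (𝓡 4) (𝓡 4) (𝓡 4) M R P :=
      hsum.of_diffeomorph_right_of_boundaryless Φ.symm (by simp)
        (ContinuousLinearEquiv.ofFinrankEq (by simp)) (ContinuousLinearEquiv.ofFinrankEq (by simp))
    exact hsum'.isOrientable_of_isOrientable (by norm_num) ih hRo

/-! ### Re-bracketing unoriented connected sums of orientable manifolds -/

/-- **Re-bracketing `P # (M # R) ⇝ (P # M) # R` without orientation conventions.**  Let `P`,
`M`, `R`, `Q` be closed connected smooth `n`-manifolds on `ℝⁿ` (`n ≥ 2`) with `P`, `M`, `R`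
orientable, `Q` a connected sum `M # R` and the closed `X` a connected sum `P # Q` (the tree's
unoriented relational `IsConnectedSum`, along arbitrary discs).  Then there is a closed connected
smooth `Y` which is a connected sum `P # M` and such that `X` is a connected sum `Y # R`.
Proof: by `IsConnectedSum.exists_isOrientedConnectedSum` (twice) there are orientations with
`(Q, oQ) = (M, ±oM) # (R, ±oR)` and `(X, oX) = (P, oP) # (Q, oQ)` ORIENTED sums (flipping all
three orientations of the inner sum if the outer one wants `−oQ`, `IsOrientedConnectedSum.neg`);
form the oriented sums `Y = (P, oP) # (M, ±oM)` and `Z = (Y, oY) # (R, ±oR)`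
(`exists_isOrientedConnectedSum_holds`; `Y` is connected, `IsConnectedSum.connectedSpace_holds`);
by the associativity of the oriented connected sum (`isOrientedConnectedSum_assoc_holds`,
Kervaire–Milnor 1963, Lemma 2.1) `Z ≅ X`, and being a connected sum `Y # R` moves along this
diffeomorphism (`IsConnectedSum.of_diffeomorph`).
[cite: KervaireMilnorAnnals1963, §2, Lemma 2.1 (p. 505)] -/
theorem IsConnectedSum.exists_rebracket {n : ℕ} (hn : 2 ≤ n) {P M R Q X : Type u}
    [TopologicalSpace P] [T2Space P] [SecondCountableTopology P]
    [ChartedSpace (EuclideanSpace ℝ (Fin n)) P] [IsManifold (𝓡 n) ∞ P] [CompactSpace P]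
    [ConnectedSpace P]
    [TopologicalSpace M] [T2Space M] [SecondCountableTopology M]
    [ChartedSpace (EuclideanSpace ℝ (Fin n)) M] [IsManifold (𝓡 n) ∞ M] [CompactSpace M]
    [ConnectedSpace M]
    [TopologicalSpace R] [T2Space R] [SecondCountableTopology R]
    [ChartedSpace (EuclideanSpace ℝ (Fin n)) R] [IsManifold (𝓡 n) ∞ R] [CompactSpace R]
    [ConnectedSpace R]
    [TopologicalSpace Q] [T2Space Q] [SecondCountableTopology Q]
    [ChartedSpace (EuclideanSpace ℝ (Fin n)) Q] [IsManifold (𝓡 n) ∞ Q] [CompactSpace Q]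
    [ConnectedSpace Q]
    [TopologicalSpace X] [T2Space X] [SecondCountableTopology X]
    [ChartedSpace (EuclideanSpace ℝ (Fin n)) X] [IsManifold (𝓡 n) ∞ X] [CompactSpace X]
    (hPo : IsOrientable (𝓡 n) P) (hMo : IsOrientable (𝓡 n) M) (hRo : IsOrientable (𝓡 n) R)
    (hQ : IsConnectedSum (𝓡 n) (𝓡 n) (𝓡 n) M R Q) (hX : IsConnectedSum (𝓡 n) (𝓡 n) (𝓡 n) P Q X) :
    ∃ (Y : Type u) (_ : TopologicalSpace Y) (_ : T2Space Y) (_ : SecondCountableTopology Y)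
      (_ : ChartedSpace (EuclideanSpace ℝ (Fin n)) Y) (_ : IsManifold (𝓡 n) ∞ Y) (_ : CompactSpace Y)
      (_ : ConnectedSpace Y),
      IsConnectedSum (𝓡 n) (𝓡 n) (𝓡 n) P M Y ∧ IsConnectedSum (𝓡 n) (𝓡 n) (𝓡 n) Y R X := by
  have hn0 : n ≠ 0 := by omega
  have h1n : 1 < finrank ℝ (EuclideanSpace ℝ (Fin n)) := by
    rw [finrank_euclideanSpace_fin]; omega
  obtain ⟨oP⟩ := hPo
  obtain ⟨oM⟩ := hMo
  obtain ⟨oR⟩ := hRo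
  -- orient the inner and the outer sum
  obtain ⟨oR', oQ, -, hQo⟩ := hQ.exists_isOrientedConnectedSum hn0 oM oR
  obtain ⟨oQ', oX, hQ', hXo⟩ := hX.exists_isOrientedConnectedSum hn0 oP oQ
  obtain ⟨oM', oR'', hQo'⟩ : ∃ (oM' : SmoothOrientation (𝓡 n) M) (oR'' : SmoothOrientation (𝓡 n) R),
      IsOrientedConnectedSum oM' oR'' oQ' := by
    rcases hQ' with rfl | rfl
    · exact ⟨oM, oR', hQo⟩
    · exact ⟨-oM, -oR', hQo.neg⟩
  -- `Y = P # M`, `Z = Y # R`, oriented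
  obtain ⟨Y, _, _, _, _, _, _, oY, hY⟩ := exists_isOrientedConnectedSum_holds (n := n) hn0 P M oP oM'
  haveI : ConnectedSpace Y := IsConnectedSum.connectedSpace_holds h1n hY.isConnectedSum
  obtain ⟨Z, _, _, _, _, _, _, oZ, hZ⟩ := exists_isOrientedConnectedSum_holds (n := n) hn0 Y R oY oR''
  -- associativity of the oriented connected sum: `Z ≅ X`
  obtain ⟨e, -⟩ := isOrientedConnectedSum_assoc_holds n P M R Y Q Z X oP oM' oR'' oY oQ' oZ oX
    hY hZ hQo' hXo
  exact ⟨Y, ‹_›, ‹_›, ‹_›, ‹_›, ‹_›, ‹_›, ‹_›, hY.isConnectedSum, hZ.isConnectedSum.of_diffeomorph e⟩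

/-! ### Additivity of `IsCircleProdSum` -/

section Add

variable {m : ℕ} {P : Type u} [TopologicalSpace P] [T2Space P] [SecondCountableTopology P]
  [ChartedSpace (EuclideanSpace ℝ (Fin 4)) P] [IsManifold (𝓡 4) ∞ P] [CompactSpace P]
  [ConnectedSpace P]

/-- **`#ᵐ(S¹ × S³) # #ⁿ(S¹ × S³) = #ᵐ⁺ⁿ(S¹ × S³)`**: if the closed connected smooth `P` is a
connected sum of `m` copies of `S¹ × S³`, the closed connected smooth `Q` one of `n` copies, and
the closed `X` is a connected sum `P # Q` (unoriented, along arbitrary discs), then `X` is a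
connected sum of `m + n` copies.  Induction on `n`: for `n = 0`, `Q ≅ S⁴` is the unit
(`IsCircleProdSum.of_isConnectedSum_zero_right`); for `n + 1`, `Q = M # (S¹ × S³)` and, after
recharting the summand on `ℝ⁴` (`exists_circleProdSphereThree_euclidean`), re-bracketing
(`IsConnectedSum.exists_rebracket`, all summands orientable by `IsCircleProdSum.isOrientable`)
gives `X = Y # (S¹ × S³)` with `Y = P # M` a connected sum of `m + n` copies by induction.  This
is the bookkeeping "both `𝒯′` and `𝒯″` satisfy the conclusions of the theorem [hence so does
`𝒯 = 𝒯′ # 𝒯″`]" of Meier–Schirmer–Zupan's proof of Thm. 1.2 (Kervaire–Milnor 1963, Lemma 2.1: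
"well defined, associative, and commutative"). [cite: KervaireMilnorAnnals1963, §2, Lemma 2.1 (p. 505)]
[cite: MeierSchirmerZupan2016, proof of Thm. 1.2 (§5)] -/
theorem IsCircleProdSum.add (hP : IsCircleProdSum m P) :
    ∀ (n : ℕ) {Q X : Type u} [TopologicalSpace Q] [T2Space Q] [SecondCountableTopology Q]
      [ChartedSpace (EuclideanSpace ℝ (Fin 4)) Q] [IsManifold (𝓡 4) ∞ Q] [CompactSpace Q]
      [ConnectedSpace Q]
      [TopologicalSpace X] [T2Space X] [SecondCountableTopology X]
      [ChartedSpace (EuclideanSpace ℝ (Fin 4)) X] [IsManifold (𝓡 4) ∞ X] [CompactSpace X],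
      IsCircleProdSum n Q → IsConnectedSum (𝓡 4) (𝓡 4) (𝓡 4) P Q X →
        IsCircleProdSum (m + n) X := by
  intro n
  induction n with
  | zero =>
    intro Q X _ _ _ _ _ _ _ _ _ _ _ _ _ hQ hX
    exact hP.of_isConnectedSum_zero_right hQ hX
  | succ n ih =>
    intro Q X _ _ _ _ _ _ _ _ _ _ _ _ _ hQ hX
    haveI := Fact.mk (@finrank_euclideanSpace_fin ℝ _ 4)
    obtain ⟨M, _, _, _, _, _, _, _, hM, hMC⟩ := isCircleProdSum_succ_iff.mp hQ
    obtain ⟨R, _, _, _, _, _, _, _, hRo, ⟨Φ⟩⟩ := exists_circleProdSphereThree_euclidean.{u}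
    -- `Q = M # R` with `R` on `ℝ⁴`
    have hMR : IsConnectedSum (𝓡 4) (𝓡 4) (𝓡 4) M R Q :=
      hMC.of_diffeomorph_right_of_boundaryless Φ.symm (by simp)
        (ContinuousLinearEquiv.ofFinrankEq (by simp)) (ContinuousLinearEquiv.ofFinrankEq (by simp))
    -- re-bracket: `X = Y # R` with `Y = P # M`
    obtain ⟨Y, _, _, _, _, _, _, _, hY, hYR⟩ := IsConnectedSum.exists_rebracket (n := 4)
      (by norm_num) hP.isOrientable hM.isOrientable hRo hMR hX
    have hY' : IsCircleProdSum (m + n) Y := ih hM hY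
    -- back to the summand `Circle × 𝕊³`
    have hYC : IsConnectedSum (𝓡 4) (𝓡 4) ((𝓡 1).prod (𝓡 3)) Y
        (Circle × (Metric.sphere (0 : EuclideanSpace ℝ (Fin 4)) 1)) X :=
      hYR.of_diffeomorph_right_of_boundaryless Φ (by simp)
        (ContinuousLinearEquiv.ofFinrankEq (by simp)) (ContinuousLinearEquiv.ofFinrankEq (by simp))
    exact .succ hY' hYC

/-- **`#ⁿ(S¹ × S³) # #ᵐ(S¹ × S³) = #ᵐ⁺ⁿ(S¹ × S³)`**, the commuted form of
`IsCircleProdSum.add` (`IsConnectedSum.symm`). [cite: KervaireMilnorAnnals1963, §2, Lemma 2.1 (p. 505)] -/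
theorem IsCircleProdSum.add_left (hP : IsCircleProdSum m P) {n : ℕ} {Q X : Type u}
    [TopologicalSpace Q] [T2Space Q] [SecondCountableTopology Q]
    [ChartedSpace (EuclideanSpace ℝ (Fin 4)) Q] [IsManifold (𝓡 4) ∞ Q] [CompactSpace Q]
    [ConnectedSpace Q]
    [TopologicalSpace X] [T2Space X] [SecondCountableTopology X]
    [ChartedSpace (EuclideanSpace ℝ (Fin 4)) X] [IsManifold (𝓡 4) ∞ X] [CompactSpace X]
    (hQ : IsCircleProdSum n Q) (hX : IsConnectedSum (𝓡 4) (𝓡 4) (𝓡 4) Q P X) :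
    IsCircleProdSum (m + n) X :=
  hP.add n hQ hX.symm

end Add

/-! ### The `ℂP²` summand moves to the outside -/

section ComplexProjectivePlane

variable {m n : ℕ} {P M Q X : Type}
  [TopologicalSpace P] [T2Space P] [SecondCountableTopology P]
  [ChartedSpace (EuclideanSpace ℝ (Fin 4)) P] [IsManifold (𝓡 4) ∞ P] [CompactSpace P]
  [ConnectedSpace P]
  [TopologicalSpace M] [T2Space M] [SecondCountableTopology M]
  [ChartedSpace (EuclideanSpace ℝ (Fin 4)) M] [IsManifold (𝓡 4) ∞ M] [CompactSpace M]
  [ConnectedSpace M]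
  [TopologicalSpace Q] [T2Space Q] [SecondCountableTopology Q]
  [ChartedSpace (EuclideanSpace ℝ (Fin 4)) Q] [IsManifold (𝓡 4) ∞ Q] [CompactSpace Q]
  [ConnectedSpace Q]
  [TopologicalSpace X] [T2Space X] [SecondCountableTopology X]
  [ChartedSpace (EuclideanSpace ℝ (Fin 4)) X] [IsManifold (𝓡 4) ∞ X] [CompactSpace X]

/-- **`#ᵐ(S¹ × S³) # (#ⁿ(S¹ × S³) # ℂP²) = #ᵐ⁺ⁿ(S¹ × S³) # ℂP²`** in the relational sense of
`msz_trisection_classification_gk`: if `P` is a connected sum of `m` copies of `S¹ × S³`, `Q` a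
connected sum `M # ℂP²` with `M` a connected sum of `n` copies, and `X` a connected sum `P # Q`
(closed connected smooth `P`, `M`, `Q`; closed `X`; universe `0`, where `ComplexProjectivePlane`
lives), then `X` is a connected sum `Y # ℂP²` with `Y` a closed connected smooth connected sum of
`m + n` copies — re-bracket (`IsConnectedSum.exists_rebracket`; `ℂP²` is orientable,
`isOrientable_complexProjectivePlane_holds`) and add (`IsCircleProdSum.add`).  This is the second
alternative in the assembly step of Meier–Schirmer–Zupan's proof of Thm. 1.2.
[cite: KervaireMilnorAnnals1963, §2, Lemma 2.1 (p. 505)] [cite: MeierSchirmerZupan2016, proof of Thm. 1.2 (§5)] -/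
theorem IsCircleProdSum.add_isConnectedSum_complexProjectivePlane (hP : IsCircleProdSum m P)
    (hM : IsCircleProdSum n M)
    (hQ : IsConnectedSum (𝓡 4) (𝓡 4) (𝓡 4) M ComplexProjectivePlane Q)
    (hX : IsConnectedSum (𝓡 4) (𝓡 4) (𝓡 4) P Q X) :
    ∃ (Y : Type) (_ : TopologicalSpace Y) (_ : T2Space Y) (_ : SecondCountableTopology Y)
      (_ : ChartedSpace (EuclideanSpace ℝ (Fin 4)) Y) (_ : IsManifold (𝓡 4) ∞ Y) (_ : CompactSpace Y)
      (_ : ConnectedSpace Y),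
      IsCircleProdSum (m + n) Y ∧ IsConnectedSum (𝓡 4) (𝓡 4) (𝓡 4) Y ComplexProjectivePlane X := by
  obtain ⟨Y, _, _, _, _, _, _, _, hY, hYC⟩ := IsConnectedSum.exists_rebracket (n := 4)
    (by norm_num) hP.isOrientable hM.isOrientable isOrientable_complexProjectivePlane_holds hQ hX
  exact ⟨Y, ‹_›, ‹_›, ‹_›, ‹_›, ‹_›, ‹_›, ‹_›, hP.add n hM hY, hYC⟩

/-- **`(#ᵐ(S¹ × S³) # ℂP²) # #ⁿ(S¹ × S³) = #ᵐ⁺ⁿ(S¹ × S³) # ℂP²`**: if `Q` is a connected sum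
`M # ℂP²` with `M` a connected sum of `m` copies of `S¹ × S³`, `P` a connected sum of `n` copies,
and `X` a connected sum `Q # P`, then `X` is a connected sum `Y # ℂP²` with `Y` a connected sum
of `m + n` copies (commute, `IsConnectedSum.symm`, and apply
`IsCircleProdSum.add_isConnectedSum_complexProjectivePlane`).
[cite: KervaireMilnorAnnals1963, §2, Lemma 2.1 (p. 505)] [cite: MeierSchirmerZupan2016, proof of Thm. 1.2 (§5)] -/
theorem IsCircleProdSum.isConnectedSum_complexProjectivePlane_add (hM : IsCircleProdSum m M)
    (hQ : IsConnectedSum (𝓡 4) (𝓡 4) (𝓡 4) M ComplexProjectivePlane Q)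
    (hP : IsCircleProdSum n P) (hX : IsConnectedSum (𝓡 4) (𝓡 4) (𝓡 4) Q P X) :
    ∃ (Y : Type) (_ : TopologicalSpace Y) (_ : T2Space Y) (_ : SecondCountableTopology Y)
      (_ : ChartedSpace (EuclideanSpace ℝ (Fin 4)) Y) (_ : IsManifold (𝓡 4) ∞ Y) (_ : CompactSpace Y)
      (_ : ConnectedSpace Y),
      IsCircleProdSum (m + n) Y ∧ IsConnectedSum (𝓡 4) (𝓡 4) (𝓡 4) Y ComplexProjectivePlane X := by
  obtain ⟨Y, _, _, _, _, _, _, _, hY, hYC⟩ :=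
    hP.add_isConnectedSum_complexProjectivePlane hM hQ hX.symm
  refine ⟨Y, ‹_›, ‹_›, ‹_›, ‹_›, ‹_›, ‹_›, ‹_›, ?_, hYC⟩
  rwa [Nat.add_comm] at hY

end ComplexProjectivePlane

end Literature.Topology.FourManifolds

end
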